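import Summits.QuantumFields.BalabanUV.Beta.GAN24.TaylorRowLamTopTableAt
import Summits.QuantumFields.BalabanUV.Beta.GAN24.TaylorRowLamTop
import Summits.QuantumFields.BalabanUV.Beta.GAN24.E3UnitSplitLevelsAt

/-!
# `BalabanUV.Beta.GAN24.TaylorRowLamTopAt` — binder row G-an2-4 / (CONV-C), road S3 AT THE IN-BLOCK ROOT: package (ρ-d), part 2 of 4, of the row owner gan24-p1-g21's
# WANTED «ROOTED-S3-Λ» ([GAN24P1-G21-ONLINE] (W5) l.34168; «MINE (ρ-d)» leaf-04 g55 l.34353; OWNER GO (W8) l.34364) — **ROW S3-Lt (the TOP Λ increment) AT THE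
# IN-BLOCK ROOT**: `rowLamTop_at (hLc : 1 ≤ Lc) (cΛ) : ∃ CtL δt, 0 < δt ∧ ∀ r ∈ box (3+1) Lc, ∀ n, LocStencil (N^{2(3+1)}·e3OfS N ((cΛ·M^{2·3+4}) • lagrIncAt 3 (toSite r) Lc M N)) CtL δt`
# (`N = Lc^{n+2}`, `M = Lc^{n+1}`) — the hypothesis `hLt` of the owner's `BornLambdaUndressedRow.exists_hUg_of_rootedRows` VERBATIM, constants BEFORE the root.

NOT IN PRINT; OUR BOOKKEEPING (G-an2-4 formalisation swarm → CRUX TEAM (2), leaf prover `b2b-balaban-gan24-formalise-leaf-04`, gen 55).  METHOD = the owner's gen-6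
`mkroot.py` rule, executed by the static script `HOME/b2b-balaban-gan24-formalise-leaf-04/g55/rho-d/mk_top_at.py` on the TREE text of `GAN24/TaylorRowLamTop` (holder leaf-10,
gen 12): base text from `noncomputable section` on; namespace `…TaylorRowLamTop` → `…TaylorRowLamTopAt`; the synthetic table is part 1's ROOTED `TaylorRowLamTopTableAt.tabT r`;
`lagrInc 3 Lc ↦ SpineRooted.lagrIncAt 3 (toSite r) Lc`; leaf-01 g60's (ρ-b) `E3UnitSplitLevelsAt.e3LamTop_unit_split (toSite r)` replaces the base unit split; the root-free
plumbing `rowR`, `rowK`, `rowCm`, `rowE` and the scalar lemmas `rowCm_nonneg`, `scalar_le`, `ratio_le_one`, `exp_supports_le` are used BY NAME from the base module (NOT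
re-declared); the owner's one-channel engine `TaylorSandwich.sandwich_bound`, the (N1) legs `StencilSlotE3HLeg.legs_three` and the K-slot leg `StencilSlotE3PhiLeg.phiLeg_three`
VERBATIM as in the base; SAME constants as the base row (`CtL`, `δt = min(κ₁, δ₂)∕2` are root-free), so the root is quantified INSIDE the `∃`.  [folklore] assembly;
0 `def`, 0 cited facts, 0 `def … : Prop`, 0 sorry; NO estimate of (N1)∕(N3) beyond the tree's, NONE of Bałaban's.  HONEST FRAMING (cell contract, verbatim): «discharging
`BetaPertH` makes Bałaban's UV stability UNCONDITIONAL — a real constructive-QFT result; it is NOT the continuum limit and NOT the Clay problem.»  HONEST DEPENDENCY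
(verbatim): «continuum YM on T⁴ ⇐ BetaPertH ∧ nine spine estimates (0/9 proved); BetaPertH ⇐ (D1) ∧ (D4) ∧ CAP+tail; G-an2-4 gates asym, D1 and NE2/3/4.»  The ROW is
ONE rooted twin of 12 road-S3 rows; it discharges NOTHING of (hS, hSall) by itself; hB ∕ hUg OPEN; NEVER «G-an2-4 closed»; NOT (CONV-C), NOT D1, NOT BetaPertH, NOT
continuum, NOT Clay.

WHAT IS PROVED ([folklore], 0 sorry): **`sandwich_le (hLc) (hr)`** (the owner's `sandwich_bound` with the rooted table), **`rowLamTop_of_legs`** (legs as hypotheses ⟹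
`∃ CtL δ, 0 < δ ∧ ∀ r ∈ box (3+1) Lc, ∀ n, LocStencil … CtL δ`), **`rowLamTop_at (hLc : 1 ≤ Lc) (cΛ)`** (hypotheses-free; the W5 `hLt`).
-/

noncomputable section

open Finset
open scoped BigOperators
open Literature.MathematicalPhysics.QuantumFieldTheory
open Literature.MathematicalPhysics.QuantumFieldTheory.LatticeForm (quo)
open Literature.Probability.LatticeModels (Torus.proj)
open Literature.MathematicalPhysics.QuantumFieldTheory.Balaban1983to89
open Literature.MathematicalPhysics.QuantumFieldTheory.Balaban1983to89.Beta
open B12Sec2to5 (l1 l1_nonneg)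
open ExpKernelCalculus (MKer Zl Zl_pos l1_sub_symm)
open AffineAveraging (Site box toSite)
open OneStepResolventKernel (Fib KInv LocStencil KInv_inr_inr_coarse quo_zsmul bound_mono)
open KernelSpecInstance (wH wΦ)
open KKTFluctuationKernel (GamΦ)
open Summit.QuantumFields.BalabanUV.Beta.SpineRooted (lagrIncAt)
open AveragingHessianKernels (ell)
open Summit.QuantumFields.BalabanUV.Beta.GAN24.E3UnitSplit (e3OfS e3OfS_inl_inr e3OfS_inr)
open Summit.QuantumFields.BalabanUV.Beta.GAN24.E3UnitSplitLevelsAt (e3LamTop_unit_split)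
open Summit.QuantumFields.BalabanUV.Beta.GAN24.TaylorSandwich (sandwich_bound)
open Summit.QuantumFields.BalabanUV.Beta.GAN24.StencilSlotE3HLeg (legs_three)
open Summit.QuantumFields.BalabanUV.Beta.GAN24.StencilSlotE3PhiLeg (phiLeg_three)
open Summit.QuantumFields.BalabanUV.Beta.GAN24.TaylorRowLamTopTable (suppU suppW l1_sub_le_of_mem_suppW l1_sub_le_of_mem_suppU)
open Summit.QuantumFields.BalabanUV.Beta.GAN24.TaylorRowLamTopTableAt (tabT vertex_sandwich_form mem_suppW_of_ne_zero mem_suppU_of_ne_zero mass_tabT_le)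
open Summit.QuantumFields.BalabanUV.Beta.GAN24.TaylorRowLamTop (rowR rowK rowCm rowE rowCm_nonneg scalar_le ratio_le_one exp_supports_le)

namespace Summit.QuantumFields.BalabanUV.Beta.GAN24.TaylorRowLamTopAt

/-! ## §3 `d = 3`: ROW S3-Lt — the top Λ increment is a local stencil family with an `n`-FREE constant -/

section Row

variable {Lc : ℕ} [NeZero Lc] {r : Fin (3 + 1) → ℕ}

/-- [folklore] **THE SANDWICH STEP** (member `n`, channel `(α, β)`): the owner's `TaylorSandwich.sandwich_bound` VERBATIM with the ROOTED synthetic table `tabT r`, its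
supports `suppW`∕`suppU`, its per-`y` mass `rowCm·M^{−4}`, and legs at a common rate `κ` with constants `C₁` (outer) and `CH` (vertex). -/
theorem sandwich_le (hLc : 1 ≤ Lc) (hr : r ∈ box (3 + 1) Lc) {κ C₁ CH : ℝ} (hκ : 0 < κ) (n : ℕ) (κ' α β : Fin (3 + 1)) (u' x' z' : Site (3 + 1))
    (hA : ∀ (l : Fin (3 + 1)) (w : Site (3 + 1)),
      |((Lc : ℝ) ^ (n + 1 + 1)) ^ (3 + 2) * GamΦ (N := Lc ^ (n + 1 + 1)) α x' l w| ≤ C₁ * Real.exp (-κ * l1 (x' - quo (Lc ^ (n + 1 + 1)) w)))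
    (hB : ∀ (l' : Fin (3 + 1)) (y : Site (3 + 1)),
      |((Lc : ℝ) ^ (n + 1 + 1)) ^ (3 + 2) * wH (N := Lc ^ (n + 1 + 1)) l' β (y - ((Lc ^ (n + 1 + 1) : ℕ) : ℤ) • z')| ≤
        C₁ * Real.exp (-κ * l1 (quo (Lc ^ (n + 1 + 1)) y - z')))
    (hH : ∀ (μ : Fin (3 + 1)) (u : Site (3 + 1)),
      |((Lc : ℝ) ^ (n + 1 + 1)) ^ (3 + 2) * wΦ (N := Lc ^ (n + 1 + 1)) κ' μ (u' - quo (Lc ^ (n + 1 + 1)) u)| ≤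
        CH * Real.exp (-κ * l1 (quo (Lc ^ (n + 1 + 1)) u - u'))) :
    |∑' y : Site (3 + 1), ∑ l' : Fin (3 + 1),
        (∑' w : Site (3 + 1), ∑ l : Fin (3 + 1), ((Lc : ℝ) ^ (n + 1 + 1)) ^ (3 + 2) * GamΦ (N := Lc ^ (n + 1 + 1)) α x' l w *
            ∑ μ : Fin (3 + 1), (((Lc : ℝ) ^ (n + 1 + 1)) ^ (3 + 1))⁻¹ *
              ∑' u : Site (3 + 1), ((Lc : ℝ) ^ (n + 1 + 1)) ^ (3 + 2) * wΦ (N := Lc ^ (n + 1 + 1)) κ' μ (u' - quo (Lc ^ (n + 1 + 1)) u) *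
                tabT (d := 3) r Lc (Lc ^ (n + 1)) (Lc ^ (n + 1 + 1)) μ u w l y l') *
          (((Lc : ℝ) ^ (n + 1 + 1)) ^ (3 + 2) * wH (N := Lc ^ (n + 1 + 1)) l' β (y - ((Lc ^ (n + 1 + 1) : ℕ) : ℤ) • z'))| ≤
      (((3 : ℕ) : ℝ) + 1) * (C₁ * C₁ * CH * (rowCm Lc * (((Lc : ℝ) ^ (n + 1)) ^ (3 + 1))⁻¹) *
        (Real.exp (κ * ((((3 : ℕ) : ℝ) + 1) * ((2 * rowR Lc * Lc ^ (n + 1) : ℕ) : ℝ) / (Lc : ℝ) ^ (n + 1 + 1) + (((3 : ℕ) : ℝ) + 1))) *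
          Real.exp (κ * ((Lc : ℝ) ^ (n + 1 + 1) * ((((3 : ℕ) : ℝ) + 1) * (rowK Lc : ℝ) + (((3 : ℕ) : ℝ) + 1)) / (Lc : ℝ) ^ (n + 1 + 1) +
            (((3 : ℕ) : ℝ) + 1))))) *
        Zl (3 + 1) (κ / 2) * Real.exp (-(κ / 2) * (l1 (x' - u') + l1 (z' - u'))) := by
  have hLc0 : (0 : ℝ) < Lc := by exact_mod_cast Nat.pos_of_ne_zero (NeZero.ne Lc)
  have hNML : Lc ^ (n + 1 + 1) = Lc ^ (n + 1) * Lc := pow_succ Lc (n + 1)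
  have hM0 : (0 : ℝ) < (Lc : ℝ) ^ (n + 1) := pow_pos hLc0 _
  have hM1 : (1 : ℝ) ≤ (Lc : ℝ) ^ (n + 1) := one_le_pow₀ (by exact_mod_cast hLc)
  have hcastN : ((Lc ^ (n + 1 + 1) : ℕ) : ℝ) = (Lc : ℝ) ^ (n + 1 + 1) := by push_cast; rfl
  have hcastM : ((Lc ^ (n + 1) : ℕ) : ℝ) = (Lc : ℝ) ^ (n + 1) := by push_cast; rfl
  -- supports, radii and mass of the synthetic table
  have hK : 2 * (((3 : ℕ) : ℝ) + 1) * (Lc + 1) + (((3 : ℕ) : ℝ) + 1) ≤ (rowK Lc : ℝ) := by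
    unfold rowK rowR; push_cast; nlinarith
  have hK₂ : 4 * (((3 : ℕ) : ℝ) + 1) * (Lc + 1) * ((Lc ^ (n + 1) : ℕ) : ℝ) ≤ ((2 * rowR Lc * Lc ^ (n + 1) : ℕ) : ℝ) := by
    unfold rowR; push_cast; nlinarith [hM0]
  have hTw : ∀ (κ'' : Fin (3 + 1)) (u w : Site (3 + 1)) (l : Fin (3 + 1)) (y : Site (3 + 1)) (l' : Fin (3 + 1)),
      tabT (d := 3) r Lc (Lc ^ (n + 1)) (Lc ^ (n + 1 + 1)) κ'' u w l y l' ≠ 0 → w ∈ suppW 3 (2 * rowR Lc * Lc ^ (n + 1)) y :=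
    fun κ'' u w l y l' h => mem_suppW_of_ne_zero hLc hr hNML hK₂ h
  have hTu : ∀ (κ'' : Fin (3 + 1)) (u w : Site (3 + 1)) (l : Fin (3 + 1)) (y : Site (3 + 1)) (l' : Fin (3 + 1)),
      tabT (d := 3) r Lc (Lc ^ (n + 1)) (Lc ^ (n + 1 + 1)) κ'' u w l y l' ≠ 0 → u ∈ suppU 3 (Lc ^ (n + 1 + 1)) (rowK Lc) y :=
    fun κ'' u w l y l' h => mem_suppU_of_ne_zero hLc hr hNML hK h
  have hRw : ∀ y : Site (3 + 1), ∀ w ∈ suppW 3 (2 * rowR Lc * Lc ^ (n + 1)) y,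
      l1 (w - y) ≤ (((3 : ℕ) : ℝ) + 1) * ((2 * rowR Lc * Lc ^ (n + 1) : ℕ) : ℝ) := fun y w hw => l1_sub_le_of_mem_suppW hw
  have hRu : ∀ y : Site (3 + 1), ∀ u ∈ suppU 3 (Lc ^ (n + 1 + 1)) (rowK Lc) y,
      l1 (u - y) ≤ ((Lc ^ (n + 1 + 1) : ℕ) : ℝ) * ((((3 : ℕ) : ℝ) + 1) * (rowK Lc : ℝ) + (((3 : ℕ) : ℝ) + 1)) :=
    fun y u hu => l1_sub_le_of_mem_suppU hu
  have hmass : ∀ (y : Site (3 + 1)) (l' : Fin (3 + 1)),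
      ∑ w ∈ suppW 3 (2 * rowR Lc * Lc ^ (n + 1)) y, ∑ l : Fin (3 + 1), ∑ μ : Fin (3 + 1), ∑ u ∈ suppU 3 (Lc ^ (n + 1 + 1)) (rowK Lc) y,
        |tabT (d := 3) r Lc (Lc ^ (n + 1)) (Lc ^ (n + 1 + 1)) μ u w l y l'| ≤ rowCm Lc * (((Lc : ℝ) ^ (n + 1)) ^ (3 + 1))⁻¹ := by
    intro y l'
    refine (mass_tabT_le (N := Lc ^ (n + 1 + 1)) hLc hr (rowK Lc) (2 * rowR Lc * Lc ^ (n + 1)) y l').trans ?_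
    rw [hcastM]
    have h1 : ((2 * (2 * rowR Lc * Lc ^ (n + 1)) + 1 : ℕ) : ℝ) ≤ ((4 * rowR Lc + 1 : ℕ) : ℝ) * (Lc : ℝ) ^ (n + 1) := by
      push_cast; nlinarith [hM1]
    have h2 : ((2 * (2 * rowR Lc * Lc ^ (n + 1)) + 1 : ℕ) : ℝ) ^ (3 + 1) ≤ ((4 * rowR Lc + 1 : ℕ) : ℝ) ^ (3 + 1) * ((Lc : ℝ) ^ (n + 1)) ^ (3 + 1) := by
      rw [← mul_pow]; exact pow_le_pow_left₀ (by positivity) h1 _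
    have h3 : ((4 * rowR Lc + 1 : ℕ) : ℝ) ^ (3 + 1) * ((Lc : ℝ) ^ (n + 1)) ^ (3 + 1) *
        ((((3 : ℕ) : ℝ) + 1) * ((((3 : ℕ) : ℝ) + 1) * (((2 * rowK Lc + 1 : ℕ) : ℝ) ^ (3 + 1) *
          (2 * (ell (3 + 1) Lc : ℝ) ^ 2 / ((Lc : ℝ) ^ (n + 1)) ^ (2 * (3 + 1)))))) = rowCm Lc * (((Lc : ℝ) ^ (n + 1)) ^ (3 + 1))⁻¹ := by
      unfold rowCm; field_simp; ring
    rw [← h3]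
    exact mul_le_mul_of_nonneg_right h2 (by positivity)
  have hsb := sandwich_bound (N := Lc ^ (n + 1 + 1)) (d := 3) (x' := x') (u' := u') (z' := z')
    (A := fun l w => ((Lc : ℝ) ^ (n + 1 + 1)) ^ (3 + 2) * GamΦ (N := Lc ^ (n + 1 + 1)) α x' l w)
    (B := fun l' y => ((Lc : ℝ) ^ (n + 1 + 1)) ^ (3 + 2) * wH (N := Lc ^ (n + 1 + 1)) l' β (y - ((Lc ^ (n + 1 + 1) : ℕ) : ℤ) • z'))
    (H := fun μ u => ((Lc : ℝ) ^ (n + 1 + 1)) ^ (3 + 2) * wΦ (N := Lc ^ (n + 1 + 1)) κ' μ (u' - quo (Lc ^ (n + 1 + 1)) u))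
    (T := tabT (d := 3) r Lc (Lc ^ (n + 1)) (Lc ^ (n + 1 + 1)))
    hκ hA hB hH hTw hTu hRw hRu hmass
  rw [hcastN] at hsb
  exact hsb

/-- [folklore] **ROW S3-Lt AT THE IN-BLOCK ROOT, FROM THE LEGS** (the base's `_of_legs` form, the root quantified INSIDE, constants BEFORE the root — they are the base's, root-free): the vertex∕right and left (N1) legs in
`StencilSlotE3HLeg.legs_three`'s literal shapes and the K-slot leg in `StencilSlotE3PhiLeg.phiLeg_three`'s first shape ⟹ `∃ CtL δ, 0 < δ ∧ hLt` (d = 3, every `Lc ≥ 1`).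
`δ = min(κ₁, δ₂)∕2`; `CtL = (|cΛ|∕Lc⁴)·((d+1)·C₁²·C₂·rowCm·rowE·Zl₄(δ))` — FREE OF `n`. -/
theorem rowLamTop_of_legs (hLc : 1 ≤ Lc) (cΛ : ℝ) {C₁ κ₁ C₂ δ₂ : ℝ} (hκ₁ : 0 < κ₁) (hC₁ : 0 ≤ C₁) (hδ₂ : 0 < δ₂) (hC₂ : 0 ≤ C₂)
    (hV : ∀ (j : ℕ) (k l : Fin (3 + 1)) (u u' : Fin (3 + 1) → ℤ),
      |((Lc : ℝ) ^ (j + 1)) ^ (3 + 2) * wH (N := Lc ^ (j + 1)) k l (u - (((Lc ^ (j + 1) : ℕ) : ℤ)) • u')| ≤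
        C₁ * Real.exp (-κ₁ * l1 (quo (Lc ^ (j + 1)) u - u')))
    (hG : ∀ (j : ℕ) (α l : Fin (3 + 1)) (x' w : Fin (3 + 1) → ℤ),
      |((Lc : ℝ) ^ (j + 1)) ^ (3 + 2) * GamΦ (N := Lc ^ (j + 1)) α x' l w| ≤ C₁ * Real.exp (-κ₁ * l1 (x' - quo (Lc ^ (j + 1)) w)))
    (hΦ : ∀ (j : ℕ) (x' w : Fin (3 + 1) → ℤ) (α β : Fin (3 + 1)),
      |((Lc : ℝ) ^ (j + 1)) ^ (2 * (3 + 1)) * KInv (N := Lc ^ (j + 1)) (d := 3) (((Lc ^ (j + 1) : ℕ) : ℤ) • x') w (Sum.inr α) (Sum.inr β)| ≤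
        C₂ * Real.exp (-δ₂ * l1 (x' - quo (Lc ^ (j + 1)) w))) :
    ∃ CtL δ : ℝ, 0 < δ ∧ ∀ (r : Fin (3 + 1) → ℕ), r ∈ box (3 + 1) Lc → ∀ n : ℕ,
      LocStencil (fun κ' u' x' z' a b => ((Lc : ℝ) ^ (n + 1 + 1)) ^ (2 * (3 + 1)) *
        e3OfS (Lc ^ (n + 1 + 1)) (fun κ u => (cΛ * ((Lc : ℝ) ^ (n + 1)) ^ (2 * 3 + 4)) •
          lagrIncAt 3 (toSite r) Lc (Lc ^ (n + 1)) (Lc ^ (n + 1 + 1)) κ u) κ' u' x' z' a b) CtL δ := by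
  set κ : ℝ := min κ₁ δ₂ with hκdef
  have hκ : 0 < κ := lt_min hκ₁ hδ₂
  have hκ₁' : κ ≤ κ₁ := min_le_left _ _
  have hκ₂' : κ ≤ δ₂ := min_le_right _ _
  have hLc0 : (0 : ℝ) < Lc := by exact_mod_cast Nat.pos_of_ne_zero (NeZero.ne Lc)
  have hZ : 0 < Zl (3 + 1) (κ / 2) := Zl_pos (half_pos hκ)
  have hCm := rowCm_nonneg (Lc := Lc)
  refine ⟨|cΛ| / (Lc : ℝ) ^ (3 + 1) * ((((3 : ℕ) : ℝ) + 1) * (C₁ * C₁ * C₂ * rowCm Lc * rowE Lc κ) * Zl (3 + 1) (κ / 2)), κ / 2, half_pos hκ,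
    fun r hr n => ?_⟩
  intro κ' u' x' z' a b
  dsimp only
  have hpos : 0 ≤ |cΛ| / (Lc : ℝ) ^ (3 + 1) * ((((3 : ℕ) : ℝ) + 1) * (C₁ * C₁ * C₂ * rowCm Lc * rowE Lc κ) * Zl (3 + 1) (κ / 2)) *
      Real.exp (-(κ / 2) * (l1 (x' - u') + l1 (z' - u'))) := by
    have : 0 ≤ rowE Lc κ := by unfold rowE; positivity
    positivity
  rcases a with α | ν
  swap
  · rw [e3OfS_inr, mul_zero, abs_zero]; exact hpos
  rcases b with β | ν'
  swap
  · rw [e3OfS_inl_inr, mul_zero, abs_zero]; exact hpos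
  -- the main case: member `n`, `N = Lc^(n+2)`, `M = Lc^(n+1)`
  have hN0 : (0 : ℝ) < (Lc : ℝ) ^ (n + 1 + 1) := pow_pos hLc0 _
  have hM0 : (0 : ℝ) < (Lc : ℝ) ^ (n + 1) := pow_pos hLc0 _
  -- (1) unit split and the Λ vertex in sandwich shape
  rw [e3LamTop_unit_split (Lc := Lc) (d := 3) (toSite r) cΛ (n + 1) (n + 1 + 1) rfl κ' u' x' z' α β]
  simp only [vertex_sandwich_form (d := 3) (Lc := Lc) (M := Lc ^ (n + 1)) (N := Lc ^ (n + 1 + 1)) hLc hr]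
  -- (2) the legs at the common rate
  have hA : ∀ (l : Fin (3 + 1)) (w : Site (3 + 1)),
      |((Lc : ℝ) ^ (n + 1 + 1)) ^ (3 + 2) * GamΦ (N := Lc ^ (n + 1 + 1)) α x' l w| ≤
        C₁ * Real.exp (-κ * l1 (x' - quo (Lc ^ (n + 1 + 1)) w)) := fun l w =>
    bound_mono (hG (n + 1) α l x' w) hC₁ le_rfl hκ₁' (l1_nonneg _)
  have hB : ∀ (l' : Fin (3 + 1)) (y : Site (3 + 1)),
      |((Lc : ℝ) ^ (n + 1 + 1)) ^ (3 + 2) * wH (N := Lc ^ (n + 1 + 1)) l' β (y - ((Lc ^ (n + 1 + 1) : ℕ) : ℤ) • z')| ≤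
        C₁ * Real.exp (-κ * l1 (quo (Lc ^ (n + 1 + 1)) y - z')) := fun l' y =>
    bound_mono (hV (n + 1) l' β y z') hC₁ le_rfl hκ₁' (l1_nonneg _)
  have hH : ∀ (μ : Fin (3 + 1)) (u : Site (3 + 1)),
      |((Lc : ℝ) ^ (n + 1 + 1)) ^ (3 + 2) * wΦ (N := Lc ^ (n + 1 + 1)) κ' μ (u' - quo (Lc ^ (n + 1 + 1)) u)| ≤
        C₂ * (((Lc : ℝ) ^ (n + 1 + 1)) ^ 3)⁻¹ * Real.exp (-κ * l1 (quo (Lc ^ (n + 1 + 1)) u - u')) := by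
    intro μ u
    have h := hΦ (n + 1) u' (((Lc ^ (n + 1 + 1) : ℕ) : ℤ) • quo (Lc ^ (n + 1 + 1)) u) κ' μ
    rw [KInv_inr_inr_coarse, quo_zsmul, l1_sub_symm] at h
    have hsplit : ((Lc : ℝ) ^ (n + 1 + 1)) ^ (3 + 2) * wΦ (N := Lc ^ (n + 1 + 1)) κ' μ (u' - quo (Lc ^ (n + 1 + 1)) u) =
        (((Lc : ℝ) ^ (n + 1 + 1)) ^ 3)⁻¹ * (((Lc : ℝ) ^ (n + 1 + 1)) ^ (2 * (3 + 1)) *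
          wΦ (N := Lc ^ (n + 1 + 1)) κ' μ (u' - quo (Lc ^ (n + 1 + 1)) u)) := by
      field_simp
      ring
    rw [hsplit, abs_mul, abs_of_pos (inv_pos.2 (pow_pos hN0 3)), mul_comm C₂, mul_assoc]
    refine mul_le_mul_of_nonneg_left ?_ (inv_pos.2 (pow_pos hN0 3)).le
    exact bound_mono h hC₂ le_rfl hκ₂' (l1_nonneg _)
  -- (3)+(4) the sandwich step
  have hsb := sandwich_le hLc hr hκ n κ' α β u' x' z' hA hB hH
  -- (5) prefactor arithmetic
  have hz : ((Lc : ℝ) ^ (n + 1 + 1)) ^ (((3 : ℕ) : ℤ) - 2) = (Lc : ℝ) ^ (n + 1 + 1) := by norm_num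
  rw [hz, abs_mul]
  have hpref : |-(cΛ / (Lc : ℝ) ^ (3 + 1)) * (Lc : ℝ) ^ (n + 1 + 1) * ((Lc : ℝ) ^ (n + 1)) ^ (3 + 3)| =
      |cΛ| / (Lc : ℝ) ^ (3 + 1) * ((Lc : ℝ) ^ (n + 1 + 1) * ((Lc : ℝ) ^ (n + 1)) ^ (3 + 3)) := by
    rw [abs_mul, abs_mul, abs_neg, abs_div, abs_of_pos (pow_pos hLc0 _), abs_of_pos hN0, abs_of_pos (pow_pos hM0 _), mul_assoc]
  rw [hpref]
  refine (mul_le_mul_of_nonneg_left hsb (by positivity)).trans ?_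
  exact scalar_le (by positivity) (by positivity) hC₁ hC₂ hCm hZ.le (Real.exp_pos _).le (by positivity)
    (exp_supports_le hκ.le hLc n) (ratio_le_one hLc n)


/-- [folklore] **ROW S3-Lt (ROW-Λt) AT `d = 3`, AT THE IN-BLOCK ROOT, HYPOTHESES-FREE** = the OWNER gan24-p1-g21's W5 shape `hLt` of `BornLambdaUndressedRow.exists_hUg_of_rootedRows`
VERBATIM: for every `Lc ≥ 1` and every real weight `cΛ` there are `CtL` and `δt > 0` such that for EVERY box root `r ∈ box (3+1) Lc` and EVERY member
`n` the unit-rescaled third-jet functional of the top Λ increment `(cΛ·M^{2·3+4}) • lagrIncAt 3 (toSite r) Lc M N` (`N = Lc^{n+2}`, `M = Lc^{n+1}`) is a `LocStencil … CtL δt` — the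
hypothesis `hLt` of `StencilSlotE3OfPieces.e3Shape_of_pieces` (staged 2cc3c5eb8d83de1a, filed p206785) with `d := 3` substituted textually, ∃-packaged at the row's own rate
(carver l.4876 (3), ref2 (h)(k)(l)); legs discharged inside by `StencilSlotE3HLeg.legs_three` ((N1), leaf-16's `FineReadoutDecay`) and `StencilSlotE3PhiLeg.phiLeg_three`
(road P1's K-slot). -/
theorem rowLamTop_at (hLc : 1 ≤ Lc) (cΛ : ℝ) :
    ∃ CtL δt : ℝ, 0 < δt ∧ ∀ (r : Fin (3 + 1) → ℕ), r ∈ box (3 + 1) Lc → ∀ n : ℕ,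
      LocStencil (fun κ' u' x' z' a b => ((Lc : ℝ) ^ (n + 1 + 1)) ^ (2 * (3 + 1)) *
        e3OfS (Lc ^ (n + 1 + 1)) (fun κ u => (cΛ * ((Lc : ℝ) ^ (n + 1)) ^ (2 * 3 + 4)) •
          lagrIncAt 3 (toSite r) Lc (Lc ^ (n + 1)) (Lc ^ (n + 1 + 1)) κ u) κ' u' x' z' a b) CtL δt := by
  obtain ⟨C₁, κ₁, hκ₁, hC₁, hV, hG⟩ := legs_three (Lc := Lc)
  obtain ⟨C₂, δ₂, hδ₂, hC₂, hΦ, -⟩ := phiLeg_three (Lc := Lc)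
  exact rowLamTop_of_legs hLc cΛ hκ₁ hC₁ hδ₂ hC₂ hV hG hΦ

end Row

end Summit.QuantumFields.BalabanUV.Beta.GAN24.TaylorRowLamTopAt

end
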